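import Summits.MatrixMultiplication.MatrixMultiplication.Theses.ReesMunnRealization
import Literature.Computability.AlgebraicComplexity.GroupAlgebraTensor

/-!
# MatrixMultiplication / ReesMunnRealization — `ReesHostBlocks` (stmt-MatrixMultiplication-4375)

Route `ReesMunnRealization`, support item `ReesHostBlocks`: for a finite group `G` with a
Wedderburn isomorphism `φ : ℂ[G] ≃ₐ[ℂ] ∏ᵢ ℂ^{dᵢ×dᵢ}`, any `n` and ANY sandwich matrix
`P : [n] × [n] → G ∪ {0}` (no invertibility needed), the contracted structure tensor of the Rees
matrix semigroup `M⁰(G; n, n; P)` in its semigroup basis `(r, g, λ)`,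
`T(z; x, y) = [ (P_{λι}).map (p ↦ (r, g·p·h, γ)) = z ]` for `x = (r, g, λ)`, `y = (ι, h, γ)`,
is a restriction of `⊕ᵢ ⟨n dᵢ, n dᵢ, n dᵢ⟩ = matMulDirectSum ℂ (n·d) (n·d) (n·d)`.

Proof (Clifford–Preston / Steinberg 2016, Ch. 5: `ℂ₀[M⁰(G;n,n;P)] = (M_n(ℂ[G]), X ∘ Y = X P̂ Y)`).
* `structureTensor_restrictsTo_sandwich`: for ANY based algebra `(A, b)` and any `m ∈ A` the
  sandwiched tensor `(z, x, y) ↦ [b_z](b_x · m · b_y)` is a restriction of the structure tensor of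
  `A` — the middle matrix is the coordinate matrix of `x ↦ b_x · m`, the outer two are identities.
* `exists_reesBasis` / `reesBasis_apply`: the basis `E_{rλ} ⊗ g` of `A = M_n(ℂ[G])` indexed by
  `Fin n × G × Fin n`, with coordinates `X ↦ (X_{rλ}).coeff g`.
* `reesBasis_repr_mul_sandwich_mul`: with `P̂_{λι} = P_{λι}` (as `single p 1`, or `0`),
  `(E_{rλ} ⊗ g) P̂ (E_{ιγ} ⊗ h) = E_{rγ} ⊗ (g P_{λι} h)` or `0` — literally the Rees tensor.
* `reesHostBlocks_proof`: `M_n(ℂ[G]) ≃ₐ M_n(∏ᵢ M_{dᵢ}(ℂ)) ≃ₐ ∏ᵢ M_n(M_{dᵢ}(ℂ)) ≃ₐ ∏ᵢ M_{n dᵢ}(ℂ)`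
  (`AlgEquiv.mapMatrix`, `Matrix.piAlgEquiv`, `Matrix.compAlgEquiv`, `Matrix.reindexAlgEquiv`
  along `finProdFinEquiv`), then `structureTensor_restrictsTo_of_algEquiv` and
  `structureTensor_blockBasis_eq_matMulDirectSum` (tree, `GroupAlgebraTensor.lean`), composed with
  the sandwich restriction by `TensorRestrictsTo.trans`.
-/

noncomputable section

open scoped BigOperators

namespace Summit.MatrixMultiplication.MatrixMultiplication.Theorems

open Literature.Computability.AlgebraicComplexity
open Literature.RepresentationTheory.FiniteGroups

/-! ### Sandwiched structure tensors are restrictions of the structure tensor -/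

section Sandwich

variable {K : Type*} [CommSemiring K] {A : Type*} [Semiring A] [Algebra K A] {ι : Type*}
  [Fintype ι]

/-- Coordinates of a sandwiched product of basis vectors: expanding `b_x · m = ∑_{x'} c_{x'} b_{x'}`
in the basis, `[b_z](b_x · m · b_y) = ∑_{x'} c_{x'} · T(z; x', y)` with `T` the structure tensor
(bilinearity of the multiplication). [folklore] -/
theorem repr_mul_mul_eq_sum_structureTensor (b : Module.Basis ι K A) (m : A) (z x y : ι) :
    b.repr (b x * m * b y) z = ∑ x', b.repr (b x * m) x' * structureTensor b z x' y := by
  conv_lhs => rw [← b.sum_repr (b x * m)]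
  rw [Finset.sum_mul, map_sum, Finsupp.finsetSum_apply]
  refine Finset.sum_congr rfl fun x' _ => ?_
  rw [smul_mul_assoc, map_smul, Finsupp.smul_apply, smul_eq_mul, structureTensor_apply]

/-- **Sandwiching is a restriction.** For a based algebra `(A, b)` and any element `m ∈ A`, the
tensor `(z, x, y) ↦ [b_z](b_x · m · b_y)` of the sandwich multiplication `x ∘ y = x m y` is a
restriction of the structure tensor of `A` in `b`: compose the second argument with the linear
map `X ↦ X · m` (coordinate matrix `B_{x x'} = [b_{x'}](b_x m)`), identities on the other two
(the contracted algebra of a Rees matrix semigroup over an algebra is such a sandwich algebra;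
Steinberg 2016, Ch. 5). [folklore] -/
theorem structureTensor_restrictsTo_sandwich [DecidableEq ι] (b : Module.Basis ι K A) (m : A) :
    TensorRestrictsTo (structureTensor b) (fun z x y => b.repr (b x * m * b y) z) := by
  refine ⟨fun z z' => if z' = z then 1 else 0, fun x x' => b.repr (b x * m) x',
    fun y y' => if y' = y then 1 else 0, fun z x y => ?_⟩
  dsimp only
  rw [Finset.sum_eq_single_of_mem z (Finset.mem_univ z) (fun a _ ha => by simp [ha]),
    repr_mul_mul_eq_sum_structureTensor]
  refine Finset.sum_congr rfl fun x' _ => ?_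
  rw [Finset.sum_eq_single_of_mem y (Finset.mem_univ y) (fun c _ hc => by simp [hc])]
  simp

end Sandwich

/-! ### The semigroup basis of `M_n(ℂ[G])` and the Rees sandwich product -/

section Rees

/-- **The Rees basis of `M_n(ℂ[G])`.** There is a `ℂ`-basis of `M_n(ℂ[G])` indexed by
`Fin n × G × Fin n` whose coordinate functionals are `X ↦ (X_{r λ}).coeff g` at `(r, g, λ)` — i.e.
the basis `E_{rλ} ⊗ g` (`reesBasis_apply`), the image of the nonzero elements `(r, g, λ)` of a Rees
matrix semigroup `M⁰(G; n, n; P)` in `M_n(ℂ[G])` (Steinberg 2016, Ch. 5). [folklore] -/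
theorem exists_reesBasis (G : Type) [Fintype G] (n : ℕ) :
    ∃ b : Module.Basis (Fin n × G × Fin n) ℂ (Matrix (Fin n) (Fin n) (MonoidAlgebra ℂ G)),
      ∀ M x, b.repr M x = (M x.1 x.2.2).coeff x.2.1 := by
  let e : Matrix (Fin n) (Fin n) (MonoidAlgebra ℂ G) ≃ₗ[ℂ] (Fin n × G × Fin n → ℂ) :=
    { toFun := fun M x => (M x.1 x.2.2).coeff x.2.1
      invFun := fun f => Matrix.of fun r l =>
        MonoidAlgebra.ofCoeff (Finsupp.equivFunOnFinite.symm fun g => f (r, g, l))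
      left_inv := fun M => by
        ext r l g
        rfl
      right_inv := fun f => by
        funext x
        rfl
      map_add' := fun M N => by
        funext x
        rfl
      map_smul' := fun c M => by
        funext x
        rfl }
  exact ⟨Module.Basis.ofEquivFun e, fun M x => Module.Basis.ofEquivFun_repr_apply e M x⟩

/-- The Rees basis vectors are the matrix units with group-element entries:
`b (r, g, λ) = E_{rλ} ⊗ g = Matrix.single r λ (single g 1)`. [folklore] -/
theorem reesBasis_apply {G : Type} [DecidableEq G] {n : ℕ}
    (b : Module.Basis (Fin n × G × Fin n) ℂ (Matrix (Fin n) (Fin n) (MonoidAlgebra ℂ G)))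
    (hb : ∀ M x, b.repr M x = (M x.1 x.2.2).coeff x.2.1) (x : Fin n × G × Fin n) :
    b x = Matrix.single x.1 x.2.2 (MonoidAlgebra.single x.2.1 1) := by
  apply b.repr.injective
  rw [Module.Basis.repr_self]
  ext x'
  rw [hb, Finsupp.single_apply, Matrix.single_apply]
  by_cases h : x.1 = x'.1 ∧ x.2.2 = x'.2.2
  · rw [if_pos h, MonoidAlgebra.coeff_single, Finsupp.single_apply]
    by_cases hg : x.2.1 = x'.2.1
    · rw [if_pos hg, if_pos (Prod.ext h.1 (Prod.ext hg h.2))]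
    · rw [if_neg hg, if_neg fun e => hg (by rw [e])]
  · rw [if_neg h, MonoidAlgebra.coeff_zero, Finsupp.zero_apply,
      if_neg fun e => h (by rw [e]; exact ⟨rfl, rfl⟩)]

/-- **The Rees product in coordinates.** With the sandwich matrix `P̂ ∈ M_n(ℂ[G])`,
`P̂_{λι} = P_{λι}` (read as `single p 1`, or `0` for the zero of `G ∪ {0}`), the product
`(E_{rλ} ⊗ g) · P̂ · (E_{ιγ} ⊗ h)` is `E_{rγ} ⊗ (g P_{λι} h)` if `P_{λι} ≠ 0` and `0` otherwise —
the multiplication `(r,g,λ)(ι,h,γ) = (r, g P_{λι} h, γ)` of `M⁰(G;n,n;P)` — so its coordinate at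
`z` is the Rees tensor entry `[(P_{λι}).map (p ↦ (r, g p h, γ)) = z]` (Clifford–Preston Thm. 3.5 /
Steinberg 2016, Ch. 5: `ℂ₀[M⁰(G;n,n;P)] ↪ M_n(ℂ[G])`, `X ∘ Y = X P̂ Y`). [folklore] -/
theorem reesBasis_repr_mul_sandwich_mul {G : Type} [Group G] [DecidableEq G] {n : ℕ}
    (b : Module.Basis (Fin n × G × Fin n) ℂ (Matrix (Fin n) (Fin n) (MonoidAlgebra ℂ G)))
    (hb : ∀ M x, b.repr M x = (M x.1 x.2.2).coeff x.2.1) (P : Fin n → Fin n → Option G)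
    (z x y : Fin n × G × Fin n) :
    b.repr (b x * Matrix.of (fun l i => (P l i).elim 0 fun p => MonoidAlgebra.single p (1 : ℂ)) *
        b y) z =
      if (P x.2.2 y.1).map (fun p => (x.1, x.2.1 * p * y.2.1, y.2.2)) = some z then (1 : ℂ)
      else 0 := by
  rw [reesBasis_apply b hb, reesBasis_apply b hb, Matrix.single_mul_mul_single, hb]
  simp only [Matrix.of_apply, Matrix.single_apply]
  cases P x.2.2 y.1 with
  | none => simp
  | some p =>
    simp only [Option.elim_some, Option.map_some, MonoidAlgebra.single_mul_single, mul_one]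
    by_cases h : x.1 = z.1 ∧ y.2.2 = z.2.2
    · rw [if_pos h, MonoidAlgebra.coeff_single, Finsupp.single_apply]
      by_cases hg : x.2.1 * p * y.2.1 = z.2.1
      · have hz : ((x.1, x.2.1 * p * y.2.1, y.2.2) : Fin n × G × Fin n) = z :=
          Prod.ext h.1 (Prod.ext hg h.2)
        rw [if_pos hg, if_pos (congrArg some hz)]
      · rw [if_neg hg, if_neg fun e => hg (by rw [← Option.some.inj e])]
    · rw [if_neg h, MonoidAlgebra.coeff_zero, Finsupp.zero_apply,
        if_neg fun e => h (by rw [← Option.some.inj e]; exact ⟨rfl, rfl⟩)]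

end Rees

/-! ### The item -/

/-- **`ReesHostBlocks`** (route `ReesMunnRealization`, item stmt-MatrixMultiplication-4375): for a
finite group `G` with `φ : ℂ[G] ≃ₐ[ℂ] ∏ᵢ ℂ^{dᵢ×dᵢ}`, any `n` and any sandwich matrix `P` (not
necessarily invertible), the contracted structure tensor of the Rees matrix semigroup
`M⁰(G; n, n; P)` in the semigroup basis is a restriction of `⊕ᵢ ⟨n dᵢ, n dᵢ, n dᵢ⟩`:
`ℂ₀[M⁰] = (M_n(ℂ[G]), X ∘ Y = X P̂ Y)` is a sandwich algebra (`structureTensor_restrictsTo_sandwich`),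
and `M_n(ℂ[G]) ≃ₐ M_n(∏ M_{dᵢ}(ℂ)) ≃ₐ ∏ M_n(M_{dᵢ}(ℂ)) ≃ₐ ∏ M_{n dᵢ}(ℂ)` whose structure tensor in
the matrix-unit basis is `matMulDirectSum ℂ (n d) (n d) (n d)`
(`structureTensor_blockBasis_eq_matMulDirectSum`). [folklore] -/
theorem reesHostBlocks_proof :
    Summit.MatrixMultiplication.MatrixMultiplication.Theses.ReesMunnRealization.ReesHostBlocks := by
  intro G _ _ _ n P r d _ φ
  obtain ⟨b, hb⟩ := exists_reesBasis G n
  -- the algebra isomorphism `M_n(ℂ[G]) ≃ₐ ∏ᵢ M_{n dᵢ}(ℂ)`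
  let Ψ : Matrix (Fin n) (Fin n) (MonoidAlgebra ℂ G) ≃ₐ[ℂ] BlockAlgebra ℂ (fun i => n * d i) :=
    (φ.mapMatrix (m := Fin n)).trans ((Matrix.piAlgEquiv ℂ).trans
      (AlgEquiv.piCongrRight fun i =>
        (Matrix.compAlgEquiv (Fin n) (Fin (d i)) ℂ ℂ).trans
          (Matrix.reindexAlgEquiv ℂ ℂ finProdFinEquiv)))
  have h1 : TensorRestrictsTo (matMulDirectSum ℂ (fun i => n * d i) (fun i => n * d i)
      (fun i => n * d i)) (structureTensor b) := by
    rw [← structureTensor_blockBasis_eq_matMulDirectSum ℂ (fun i => n * d i)]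
    exact structureTensor_restrictsTo_of_algEquiv b (blockBasis ℂ fun i => n * d i) Ψ
  have h2 := structureTensor_restrictsTo_sandwich b
    (Matrix.of fun l i => (P l i).elim 0 fun p => MonoidAlgebra.single p (1 : ℂ))
  have key : (fun z x y : Fin n × G × Fin n =>
      if (P x.2.2 y.1).map (fun p => (x.1, x.2.1 * p * y.2.1, y.2.2)) = some z then (1 : ℂ)
      else 0) =
      fun z x y => b.repr (b x *
        Matrix.of (fun l i => (P l i).elim 0 fun p => MonoidAlgebra.single p (1 : ℂ)) * b y) z := by
    funext z x y
    exact (reesBasis_repr_mul_sandwich_mul b hb P z x y).symm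
  rw [key]
  exact h1.trans h2

end Summit.MatrixMultiplication.MatrixMultiplication.Theorems

end
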